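import Summits.RiemannHypothesis.RiemannHypothesis.Theses.JensenPolynomials
import Summits.RiemannHypothesis.RiemannHypothesis.Theorems.JensenPolynomialsCapCertKernelRuns
import Summits.RiemannHypothesis.RiemannHypothesis.Theorems.JensenPolynomialsCapCertSound
import Summits.RiemannHypothesis.RiemannHypothesis.Theorems.JensenPolynomialsCapTailSound
import Summits.RiemannHypothesis.RiemannHypothesis.Theorems.JensenPolynomialsCapTailRun

/-!
# Route `JensenPolynomials` — crux children `XiCumulantMajorantCap` (stmt-RiemannHypothesis-19217, pin `10⁴`) and
`XiCumulantMajorantCapFar` (stmt-RiemannHypothesis-19472, FAR pin `2·10¹⁸`) CLOSED for every `d ≥ 3`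
(cell rh-jensen, engine seat g4; RH-FREE, γ-FREE; KERNEL theorems, standard axioms — no `native_decide`, no hypothesis)

Both all-plus majorant sums of the item (caps `a(k)(k−1)!2^{k/2}M^{−(k−2)/2}` at the pin `M = max(N, 2d³) + d`, table
`rhoWinMin`, weights `(2/B_d)^j`) are `< 1` for EVERY `d ≥ 3`:
* `3 ≤ d ≤ 99`: the per-degree checker `capCheck` of engine seat eng-2 (parts 1–6, soundness `capCheckRange_sound`)
  evaluated by the KERNEL (`JensenPolynomialsCapCertKernelRuns`, `decide +kernel`);
* `d ≥ 100`, all at once: the uniform tail certificate (`JensenPolynomialsCapTail*`: `tailCheck_sound` + `tailCheck_true`);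
* the FAR pin by antitonicity: the caps are antitone in `M` for every order `k ≥ 2`, the cumulant polynomials `e_j` are
  monotone in nonnegative caps (`cumulantCoeff_abs_le`, tree) and all weights are `≥ 0`, so each far sum is `≤` the same
  sum at the pin `max(10⁴, 2d³) + d` (`capSums_le_of_pin`; the same fact as eng-2's `capSums_antitone`, stated for natural
  pins so that this closer depends only on standard-axiom modules).
`xiCumulantMajorantCap_item` / `xiCumulantMajorantCapFar_item` state the route declarations BY NAME.  Elementary arithmetic on a
fixed majorant series — nothing here is a statement about `ξ` or `ζ`, and nothing here bears on the truth of RH.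
-/

-- D-0017: `Summit.RiemannHypothesis.RiemannHypothesis.…` duplicates the namespace BY DESIGN (single-problem summit).
set_option linter.dupNamespace false

namespace Summit.RiemannHypothesis.RiemannHypothesis.Theorems.JensenPolynomials.CapCert

open Finset
open Summit.RiemannHypothesis.RiemannHypothesis.Theorems.JensenPolynomials

/-- **Both majorant sums `< 1` for EVERY `d ≥ 3` at the pin `max(10⁴, 2d³) + d`** (kernel runs for `d ≤ 99`, uniform tail
for `d ≥ 100`; standard axioms). -/
theorem capSums_lt_one (d : ℕ) (hd : 3 ≤ d) :
    (∑ j ∈ Finset.range d, (d.descFactorial (j + 1) : ℝ) *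
        cumulantCoeff (fun k : ℕ => (if k ≤ 3 then (9 / 8 : ℝ) else (k : ℝ) * 4 ^ (k - 3) / 3) *
          (Nat.factorial (k - 1) : ℝ) * (2 : ℝ) ^ ((k : ℝ) / 2) /
            ((max 10000 (2 * d ^ 3) + d : ℕ) : ℝ) ^ (((k : ℝ) - 2) / 2)) (j + 1) * rhoWinMin d (j + 1) < 1) ∧
    (∑ j ∈ Finset.range d, (d.descFactorial (j + 1) : ℝ) *
        cumulantCoeff (fun k : ℕ => (if k ≤ 3 then (9 / 8 : ℝ) else (k : ℝ) * 4 ^ (k - 3) / 3) *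
          (Nat.factorial (k - 1) : ℝ) * (2 : ℝ) ^ ((k : ℝ) / 2) /
            ((max 10000 (2 * d ^ 3) + d : ℕ) : ℝ) ^ (((k : ℝ) - 2) / 2)) (j + 1) *
          (2 / hermiteTestBound d) ^ (j + 1) < 1) := by
  by_cases h1 : d < 40
  · exact capCheckRange_sound capCheckRange_3_37_kernel hd (by omega)
  by_cases h2 : d < 70
  · exact capCheckRange_sound capCheckRange_40_30_kernel (by omega) (by omega)
  by_cases h3 : d < 100
  · exact capCheckRange_sound capCheckRange_70_30_kernel (by omega) (by omega)
  · exact tailCheck_sound tailCheck_true d (by change 100 ≤ d; omega)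

/-- **Item stmt-RiemannHypothesis-19217 `XiCumulantMajorantCap`, proved** (the route declaration by name). -/
theorem xiCumulantMajorantCap_item :
    Summit.RiemannHypothesis.RiemannHypothesis.Theses.JensenPolynomials.XiCumulantMajorantCap := by
  unfold Summit.RiemannHypothesis.RiemannHypothesis.Theses.JensenPolynomials.XiCumulantMajorantCap
  exact capSums_lt_one

/-- **Monotonicity in the pin (natural pins `10⁴ ≤ N`)**: both majorant sums at the pin `max(N, 2d³) + d` are `≤` the sums at
the pin `max(10⁴, 2d³) + d`. -/
theorem capSums_le_of_pin (N : ℕ) (hN : 10000 ≤ N) (d : ℕ) (hd : 3 ≤ d) :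
    (∑ j ∈ Finset.range d, (d.descFactorial (j + 1) : ℝ) *
        cumulantCoeff (fun k : ℕ => (if k ≤ 3 then (9 / 8 : ℝ) else (k : ℝ) * 4 ^ (k - 3) / 3) *
          (Nat.factorial (k - 1) : ℝ) * (2 : ℝ) ^ ((k : ℝ) / 2) /
            ((max N (2 * d ^ 3) + d : ℕ) : ℝ) ^ (((k : ℝ) - 2) / 2)) (j + 1) * rhoWinMin d (j + 1)
      ≤ ∑ j ∈ Finset.range d, (d.descFactorial (j + 1) : ℝ) *
        cumulantCoeff (fun k : ℕ => (if k ≤ 3 then (9 / 8 : ℝ) else (k : ℝ) * 4 ^ (k - 3) / 3) *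
          (Nat.factorial (k - 1) : ℝ) * (2 : ℝ) ^ ((k : ℝ) / 2) /
            ((max 10000 (2 * d ^ 3) + d : ℕ) : ℝ) ^ (((k : ℝ) - 2) / 2)) (j + 1) * rhoWinMin d (j + 1)) ∧
    (∑ j ∈ Finset.range d, (d.descFactorial (j + 1) : ℝ) *
        cumulantCoeff (fun k : ℕ => (if k ≤ 3 then (9 / 8 : ℝ) else (k : ℝ) * 4 ^ (k - 3) / 3) *
          (Nat.factorial (k - 1) : ℝ) * (2 : ℝ) ^ ((k : ℝ) / 2) /
            ((max N (2 * d ^ 3) + d : ℕ) : ℝ) ^ (((k : ℝ) - 2) / 2)) (j + 1) * (2 / hermiteTestBound d) ^ (j + 1)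
      ≤ ∑ j ∈ Finset.range d, (d.descFactorial (j + 1) : ℝ) *
        cumulantCoeff (fun k : ℕ => (if k ≤ 3 then (9 / 8 : ℝ) else (k : ℝ) * 4 ^ (k - 3) / 3) *
          (Nat.factorial (k - 1) : ℝ) * (2 : ℝ) ^ ((k : ℝ) / 2) /
            ((max 10000 (2 * d ^ 3) + d : ℕ) : ℝ) ^ (((k : ℝ) - 2) / 2)) (j + 1) * (2 / hermiteTestBound d) ^ (j + 1)) := by
  -- the two pins as reals
  set M : ℝ := ((max 10000 (2 * d ^ 3) + d : ℕ) : ℝ) with hM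
  set M' : ℝ := ((max N (2 * d ^ 3) + d : ℕ) : ℝ) with hM'
  have hMpos : 0 < M := by
    rw [hM]; exact_mod_cast (show 0 < max 10000 (2 * d ^ 3) + d by have := le_max_left 10000 (2 * d ^ 3); omega)
  have hMM : M ≤ M' := by
    rw [hM, hM']
    exact_mod_cast Nat.add_le_add_right (max_le_max hN le_rfl) d
  have hM'pos : 0 < M' := hMpos.trans_le hMM
  -- the cap sequences
  set U : ℕ → ℝ := fun k : ℕ => (if k ≤ 3 then (9 / 8 : ℝ) else (k : ℝ) * 4 ^ (k - 3) / 3) *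
      (Nat.factorial (k - 1) : ℝ) * (2 : ℝ) ^ ((k : ℝ) / 2) / M' ^ (((k : ℝ) - 2) / 2) with hU
  set V : ℕ → ℝ := fun k : ℕ => (if k ≤ 3 then (9 / 8 : ℝ) else (k : ℝ) * 4 ^ (k - 3) / 3) *
      (Nat.factorial (k - 1) : ℝ) * (2 : ℝ) ^ ((k : ℝ) / 2) / M ^ (((k : ℝ) - 2) / 2) with hV
  have hnum : ∀ k : ℕ, 0 ≤ (if k ≤ 3 then (9 / 8 : ℝ) else (k : ℝ) * 4 ^ (k - 3) / 3) *
      (Nat.factorial (k - 1) : ℝ) * (2 : ℝ) ^ ((k : ℝ) / 2) := by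
    intro k
    apply mul_nonneg (mul_nonneg _ (Nat.cast_nonneg _)) (Real.rpow_nonneg (by norm_num) _)
    split_ifs <;> positivity
  have hU0 : ∀ k, 0 ≤ U k := fun k => by
    rw [hU]; exact div_nonneg (hnum k) (Real.rpow_nonneg hM'pos.le _)
  have hUV : ∀ k, 3 ≤ k → |U k| ≤ V k := by
    intro k hk
    rw [abs_of_nonneg (hU0 k), hU, hV]
    have he : 0 ≤ ((k : ℝ) - 2) / 2 := by
      have : (3 : ℝ) ≤ k := by exact_mod_cast hk
      linarith
    have hpow : M ^ (((k : ℝ) - 2) / 2) ≤ M' ^ (((k : ℝ) - 2) / 2) := Real.rpow_le_rpow hMpos.le hMM he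
    exact div_le_div_of_nonneg_left (hnum k) (Real.rpow_pos_of_pos hMpos _) hpow
  have hmaj : ∀ j, cumulantCoeff U j ≤ cumulantCoeff V j := fun j =>
    (abs_le.mp (cumulantCoeff_abs_le U V j (fun k hk _ => hUV k hk) j le_rfl).1).2
  have hB : 0 < hermiteTestBound d := by unfold hermiteTestBound; positivity
  constructor
  · apply Finset.sum_le_sum; intro j _
    exact mul_le_mul_of_nonneg_right (mul_le_mul_of_nonneg_left (hmaj _) (Nat.cast_nonneg _))
      (rhoWinMin_nonneg d (j + 1) hd (by omega))
  · apply Finset.sum_le_sum; intro j _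
    exact mul_le_mul_of_nonneg_right (mul_le_mul_of_nonneg_left (hmaj _) (Nat.cast_nonneg _)) (by positivity)

/-- **Item stmt-RiemannHypothesis-19472 `XiCumulantMajorantCapFar`, proved** (the route declaration by name; pin `2·10¹⁸`). -/
theorem xiCumulantMajorantCapFar_item :
    Summit.RiemannHypothesis.RiemannHypothesis.Theses.JensenPolynomials.XiCumulantMajorantCapFar := by
  unfold Summit.RiemannHypothesis.RiemannHypothesis.Theses.JensenPolynomials.XiCumulantMajorantCapFar
  intro d hd
  have hmono := capSums_le_of_pin (2 * 10 ^ 18) (by norm_num) d hd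
  have hbase := capSums_lt_one d hd
  exact ⟨hmono.1.trans_lt hbase.1, hmono.2.trans_lt hbase.2⟩

end Summit.RiemannHypothesis.RiemannHypothesis.Theorems.JensenPolynomials.CapCert
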